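import Literature.Computability.QuantumComplexity.SampleQueryAccess
import HarnessLib

/-!
# Approximate matrix products by ℓ²-importance (row-norm) sampling

Drineas, Kannan, Mahoney, *Fast Monte Carlo algorithms for matrices I: approximating matrix
multiplication*, SIAM J. Comput. 36(1) (2006) 132–157, **§4** (the `BasicMatrixMultiplication`
algorithm of Fig. 2, Lemma 3 and Lemma 4, eq. (4)) and **Appendix A.3, Lemma 8, eq. (46)–(47)**
(non-optimal probabilities `p_k ≥ β‖A^{(k)}‖²/‖A‖_F²` give `E‖AB − CR‖_F² ≤ ‖A‖_F²‖B‖_F²/(βc)`);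
restated for sampling-and-query access by Chia, Gilyén, Li, Lin, Tang, Wang, J. ACM 69(5):33
(2022) = arXiv:1910.06151, **§2.3 "Matrix sketches"** (Def. 2.12 "sampled according to `p`" /
importance sampling sketch, Remark 2.13) and **§3.2 "Technical tools", Lemma "Asymmetric matrix
multiplication to Frobenius norm error [DKM06]"** (proof in §5.2, after Lemma 5.1 "Frobenius norm
bounds for matrix sketches"):

> Consider `X ∈ ℂ^{m×n}`, `Y ∈ ℂ^{m×p}`, and take `S ∈ ℝ^{s×m}` to be sampled according to `p ∈ ℝ^m`
> a `φ`-oversampled importance sampling distribution from `X` or `Y`. Then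
> `E[‖X†S†SY − X†Y‖_F²] ≤ (φ/s)‖X‖_F²‖Y‖_F²` and
> `E[∑_{i=1}^s ‖[SX](i,·)‖²‖[SY](i,·)‖²] ≤ (φ/s)‖X‖_F²‖Y‖_F²`.

This is the workhorse of every sampling-and-query ("quantum-inspired") dequantization (CGLLTW 2022
§1.3 "Key lemma [DKM06]": importance sampling approximates matrix products); the inner-product
estimator of `SampleQueryAccess.lean` (Tang 2019, Prop. 4.2) is its `n = p = 1` case.  Here it is a
THEOREM about finite weighted sums: the sample sequence `ω = (ω₁,…,ω_s) ∈ [m]^s` carries the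
i.i.d. weight `∏_t p(ω_t)` (`iidWeight`), `E[·]` is `∑_ω iidWeight p ω · (·)`, and everything
printed above is proved, in DKM06's order:

* the product sample space: total mass `1` (`sum_iidWeight`), marginals (`sum_iidWeight_mul_apply`),
  independence of distinct coordinates (`sum_iidWeight_mul_apply_mul_apply`), and "the variance of
  independent samples decreases as `1/s`" (`sum_iidWeight_mul_sq_sum`, `sum_iidWeight_mul_sq_avg_sub`)
  — the step with which CGLLTW's proof begins ("It suffices to consider `s = 1`");
* Def. 2.12: the sketch `S` with rows `e_{ω_t}/√(s p(ω_t))` (`sketch`), `[SX](t,·) = X(ω_t,·)/√(s p(ω_t))`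
  (`sketch_mul_apply`), `‖[SX](t,·)‖² = ‖X(ω_t,·)‖²/(s p(ω_t))` (`normSq_sketch_mul_row`), and
  `XᵀSᵀSY = (1/s) ∑_t X(ω_t,·)ᵀY(ω_t,·)/p(ω_t)` (`sketch_transpose_mul_sketch`; DKM06 Fig. 2:
  `CR = ∑_t A^{(i_t)}B_{(i_t)}/(c p_{i_t})`);
* DKM06 Lemma 3: `E[(CR)_{ij}] = (AB)_{ij}` (`iid_mean_sketchProd`) and
  `Var[(CR)_{ij}] = (1/c)∑_k A_{ik}²B_{kj}²/p_k − (1/c)(AB)_{ij}²` (`iid_var_sketchProd_entry`);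
* DKM06 Lemma 4, eq. (4): `E‖AB − CR‖_F² = (1/c)∑_k ‖A^{(k)}‖²‖B_{(k)}‖²/p_k − (1/c)‖AB‖_F²`
  (`iid_frobSq_sub`); eqs. (5)–(6): for the optimal probabilities
  `p_k = |A^{(k)}||B_{(k)}|/∑_{k'}|A^{(k')}||B_{(k')}|`, `E‖AB − CR‖_F² = (1/c)(∑_k |A^{(k)}||B_{(k)}|)²
  − (1/c)‖AB‖_F²` (`iid_frobSq_sub_optimal`), and "this choice of `p_k` minimizes `E‖AB − CR‖_F²`
  among possible choices for the sampling probabilities" (`iid_frobSq_sub_ge_optimal`, section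
  `optimal` at the end of the file);
* DKM06 Lemma 8 eq. (47) = CGLLTW's first inequality, with `φ = 1/β`: `E‖XᵀSᵀSY − XᵀY‖_F² ≤
  (φ/s)‖X‖_F²‖Y‖_F²` for `p` oversampled from `X` (`iid_frobSq_sub_le`) or from `Y`
  (`iid_frobSq_sub_le'`); CGLLTW's second inequality in the exact form of its proof
  (`iid_sum_normSq_row_mul`, `= s∑_k p(k)‖X(k,·)‖²‖Y(k,·)‖²/(s²p(k)²)`) and as printed
  (`iid_sum_normSq_row_mul_le`);
* Remark 2.13 / Lemma 5.1 (the parts without Hoeffding): `‖[SX](t,·)‖² ≤ (φ/s)‖X‖_F²`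
  (`normSq_sketch_mul_row_le`; equality for `φ = 1`, `normSq_sketch_mul_row_eq`), `‖SX‖_F² ≤ φ‖X‖_F²`
  always (`frobSq_sketch_mul_le`), `E‖SX‖_F² = ‖X‖_F²` (`iid_frobSq_sketch_mul`);
* the Markov/Chebyshev form in which the lemma is used ("which we can use together with
  Chebyshev's inequality", §3.2): the `p`-mass of `{ω : ‖XᵀSᵀSY − XᵀY‖_F² ≥ a}` is
  `≤ (φ/s)‖X‖_F²‖Y‖_F²/a` (`iid_mass_frobSq_sub_ge_le`).

Conventions.  As in `SampleQueryAccess.lean`, entries are real (`-- TODO(general form): RCLike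
entries`; all quantities depend on entries through products of pairs, and every dequantized
application in CGLLTW §6 is real), matrices are `Matrix (Fin m) (Fin n) ℝ` with `X k` the `k`-th
ROW, so CGLLTW's `X†Y = ∑_k X(k,·)†Y(k,·)` is `Xᵀ * Y` and DKM06's column/row form `AB` is the case
`X = Aᵀ, Y = B`.  "`p` is a `φ`-oversampled importance sampling distribution from `X`" is
`IsOversampledDist φ (rowNorms X) p` (Def. 2.7 applied to the row-norm vector `a` of Def. 2.9;
`lengthSqDist (rowNorms X) = rowDist X`).  Division junk values: Lean's `x/0 = 0` makes
`∑_k ‖X(k,·)‖²‖Y(k,·)‖²/p(k)` drop the indices with `p(k) = 0`; the exact identities (Lemma 3, 4)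
therefore carry the support hypothesis `p(k) = 0 → X(k,·) = 0 ∨ Y(k,·) = 0` (without which the
estimator is biased — implicit in DKM06, where (4) is read with `p_k > 0`), and this hypothesis is
DISCHARGED by oversampling (`IsOversampledDist.row_eq_zero`), so the printed inequalities carry
exactly the printed hypotheses (`φ > 0` is forced by Def. 2.7 for `X ≠ 0`; `s ≥ 1`).  Not
formalized here: running-time bookkeeping.  The Hoeffding half of Lemma 5.1 is
`SketchNormConcentration.lean` (`iid_mass_abs_frobSq_sketch_sub_ge_le`, `frobenius_norm_bounds`),
and the high-probability forms — §5.2 Lemma "Matrix multiplication by subsampling [DKM06]"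
(McDiarmid; DKM06 Thm. 1) and the §3.2 key lemma "Approximating matrix multiplication to Frobenius
norm error; corollary of [DKM06]" (`S` sampled according to `(p+q)/2`, failure `δ` with
`√(8φ₁φ₂ log(2/δ)/s)`) — are `SubsampledMatrixProduct.lean` (`subsampled_matrix_product'`,
`approx_matrix_product'`), via `Literature/Probability/Moments/McDiarmidWeighted.lean`.  No named
facts are
introduced; everything stated is proved.

## References
* [DrineasKannanMahoney2006] P. Drineas, R. Kannan, M. W. Mahoney, SIAM J. Comput. 36(1):132–157,
  2006, doi:10.1137/S0097539704442684 — §4.1 Fig. 2 (p. 138), §4.3 Lemma 3 (p. 140), Lemma 4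
  eq. (4) (pp. 140–141), App. A.3 Lemma 8 eq. (46)–(47) (p. 154).
* [ChiaEtAl2022] N.-H. Chia, A. Gilyén, T. Li, H.-H. Lin, E. Tang, C. Wang, J. ACM 69(5):33, 2022,
  doi:10.1145/3549524 (= arXiv:1910.06151; section/lemma numbering below follows the arXiv text
  held as `paper:arxiv-1910.06151`) — §2.3 Def. 2.12, Remark 2.13; §3.2 Lemma "Asymmetric matrix
  multiplication to Frobenius norm error [DKM06]"; §5.2 Lemma 5.1 and the proof of the former.
* [AroraBarak2009] S. Arora, B. Barak, *Computational Complexity*, CUP 2009, Lemma A.12 and §7.4.1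
  (Chebyshev / Markov, independent repetitions) — for the finite-probability bookkeeping.
-/

noncomputable section

namespace Literature.Computability.QuantumComplexity

namespace SampleQuery

open Finset

open scoped Matrix

/-! ### The product sample space `[m]^s` with i.i.d. weights

DKM06 Fig. 2: "Pick `i_t ∈ {1,…,n}` with `Pr[i_t = k] = p_k`, `k = 1,…,n`, independently and with
replacement"; CGLLTW Def. 2.12: "each row of `S` is independently chosen to be `e_i/√(s p(i))` with
probability `p_i`".  The law of the sample sequence is the product weight below; expectations are
finite weighted sums over `Fin s → B`. -/

section iid

variable {B : Type*} [Fintype B] {s : ℕ}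

/-- The probability of the sample sequence `ω = (ω₁,…,ω_s)` when the `ω_t` are drawn independently
with replacement from the probability vector `p`: `∏_t p(ω_t)`.
[cite: DrineasKannanMahoney2006, §4.1 Fig. 2 (step 1(a))]; [cite: ChiaEtAl2022, Def. 2.12] -/
def iidWeight (p : B → ℝ) (ω : Fin s → B) : ℝ := ∏ t, p (ω t)

omit [Fintype B] in
/-- The i.i.d. weight is nonnegative. [cite: DrineasKannanMahoney2006, §4.1 Fig. 2 (`p_i ≥ 0`)] -/
theorem iidWeight_nonneg {p : B → ℝ} (hp : ∀ b, 0 ≤ p b) (ω : Fin s → B) : 0 ≤ iidWeight p ω :=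
  prod_nonneg fun t _ => hp (ω t)

/-- Product of per-coordinate factors summed over the product space is the product of the sums
(Fubini for `[m]^s`). [cite: AroraBarak2009, §7.4.1 (independent repetitions)] -/
theorem sum_prod_apply (F : Fin s → B → ℝ) :
    ∑ ω : Fin s → B, ∏ t, F t (ω t) = ∏ t, ∑ b, F t b := by
  classical
  rw [← Fintype.piFinset_univ, ← Finset.prod_univ_sum (fun _ => (Finset.univ : Finset B)) F]

/-- Total mass `∑_ω ∏_t p(ω_t) = (∑_b p(b))^s = 1`.
[cite: DrineasKannanMahoney2006, §4.1 Fig. 2 (`∑ p_i = 1`)] -/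
theorem sum_iidWeight {p : B → ℝ} (hp : ∑ b, p b = 1) : ∑ ω : Fin s → B, iidWeight p ω = 1 := by
  unfold iidWeight
  rw [sum_prod_apply]
  simp [hp]

/-- **Marginal.** `E[f(ω_t)] = ∑_b p(b) f(b)` (DKM06: "`E[X_t] = ∑_k p_k A_{ik}B_{kj}/(c p_k)`").
[cite: DrineasKannanMahoney2006, §4.3, proof of Lemma 3] -/
theorem sum_iidWeight_mul_apply {p : B → ℝ} (hp : ∑ b, p b = 1) (f : B → ℝ) (t : Fin s) :
    ∑ ω : Fin s → B, iidWeight p ω * f (ω t) = ∑ b, p b * f b := by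
  classical
  set F : Fin s → B → ℝ := fun u b => if u = t then p b * f b else p b with hF
  have hprod : ∀ ω : Fin s → B, iidWeight p ω * f (ω t) = ∏ u, F u (ω u) := by
    intro ω
    unfold iidWeight
    rw [← Finset.mul_prod_erase _ _ (Finset.mem_univ t),
      ← Finset.mul_prod_erase (Finset.univ) (fun u => F u (ω u)) (Finset.mem_univ t)]
    have h1 : F t (ω t) = p (ω t) * f (ω t) := by simp [hF]
    have h2 : ∏ u ∈ Finset.univ.erase t, F u (ω u) = ∏ u ∈ Finset.univ.erase t, p (ω u) :=
      Finset.prod_congr rfl fun u hu => by simp [hF, Finset.ne_of_mem_erase hu]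
    rw [h1, h2]; ring
  simp only [hprod]
  rw [sum_prod_apply, ← Finset.mul_prod_erase _ _ (Finset.mem_univ t)]
  have hrest : ∏ u ∈ Finset.univ.erase t, ∑ b, F u b = 1 := by
    refine Finset.prod_eq_one fun u hu => ?_
    simp [hF, Finset.ne_of_mem_erase hu, hp]
  rw [hrest, mul_one]
  simp [hF]

/-- **Independence of distinct coordinates.** For `t ≠ u`,
`E[f(ω_t) g(ω_u)] = (∑_b p(b) f(b)) (∑_b p(b) g(b))` ("Since `(CR)_{ij}` is the sum of `c`
independent random variables, `Var[(CR)_{ij}] = ∑_t Var[X_t]`").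
[cite: DrineasKannanMahoney2006, §4.3, proof of Lemma 3]; [cite: AroraBarak2009, §7.4.1] -/
theorem sum_iidWeight_mul_apply_mul_apply {p : B → ℝ} (hp : ∑ b, p b = 1) (f g : B → ℝ)
    {t u : Fin s} (htu : t ≠ u) :
    ∑ ω : Fin s → B, iidWeight p ω * (f (ω t) * g (ω u))
      = (∑ b, p b * f b) * (∑ b, p b * g b) := by
  classical
  set F : Fin s → B → ℝ :=
    fun v b => if v = t then p b * f b else if v = u then p b * g b else p b with hF
  have hprod : ∀ ω : Fin s → B, iidWeight p ω * (f (ω t) * g (ω u)) = ∏ v, F v (ω v) := by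
    intro ω
    unfold iidWeight
    have hu' : u ∈ Finset.univ.erase t := Finset.mem_erase.2 ⟨htu.symm, Finset.mem_univ u⟩
    rw [← Finset.mul_prod_erase _ _ (Finset.mem_univ t), ← Finset.mul_prod_erase _ _ hu',
      ← Finset.mul_prod_erase (Finset.univ) (fun v => F v (ω v)) (Finset.mem_univ t),
      ← Finset.mul_prod_erase _ (fun v => F v (ω v)) hu']
    have h1 : F t (ω t) = p (ω t) * f (ω t) := by simp [hF]
    have h2 : F u (ω u) = p (ω u) * g (ω u) := by simp [hF, htu.symm]
    have h3 : ∏ v ∈ (Finset.univ.erase t).erase u, F v (ω v)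
        = ∏ v ∈ (Finset.univ.erase t).erase u, p (ω v) :=
      Finset.prod_congr rfl fun v hv => by
        have hvu : v ≠ u := Finset.ne_of_mem_erase hv
        have hvt : v ≠ t := Finset.ne_of_mem_erase (Finset.mem_of_mem_erase hv)
        simp [hF, hvu, hvt]
    rw [h1, h2, h3]; ring
  simp only [hprod]
  have hu' : u ∈ Finset.univ.erase t := Finset.mem_erase.2 ⟨htu.symm, Finset.mem_univ u⟩
  rw [sum_prod_apply, ← Finset.mul_prod_erase _ _ (Finset.mem_univ t),
    ← Finset.mul_prod_erase _ _ hu']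
  have hrest : ∏ v ∈ (Finset.univ.erase t).erase u, ∑ b, F v b = 1 := by
    refine Finset.prod_eq_one fun v hv => ?_
    have hvu : v ≠ u := Finset.ne_of_mem_erase hv
    have hvt : v ≠ t := Finset.ne_of_mem_erase (Finset.mem_of_mem_erase hv)
    simp [hF, hvu, hvt, hp]
  rw [hrest, mul_one]
  simp [hF, htu.symm]

/-- **Variance of a sum of independent centred terms.** If `∑_b p(b) D(b) = 0` then
`E[(∑_t D(ω_t))²] = s · ∑_b p(b) D(b)²`.
[cite: DrineasKannanMahoney2006, §4.3, proof of Lemma 3 — our paraphrase `Var[(CR)_{ij}] = ∑_{t=1}^c Var[X_t]`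
of the displayed decomposition of `(CR)_{ij}` as a sum over the `c` independent trials];
[cite: AroraBarak2009, Lemma A.12] -/
theorem sum_iidWeight_mul_sq_sum {p : B → ℝ} (hp : ∑ b, p b = 1) (D : B → ℝ)
    (hD : ∑ b, p b * D b = 0) :
    ∑ ω : Fin s → B, iidWeight p ω * (∑ t, D (ω t)) ^ 2 = s * ∑ b, p b * D b ^ 2 := by
  have hexp : ∀ ω : Fin s → B, iidWeight p ω * (∑ t, D (ω t)) ^ 2
      = ∑ t, ∑ u, iidWeight p ω * (D (ω t) * D (ω u)) := fun ω => by
    rw [pow_two, Finset.sum_mul_sum, Finset.mul_sum]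
    refine Finset.sum_congr rfl fun t _ => ?_
    rw [Finset.mul_sum]
  simp only [hexp]
  rw [Finset.sum_comm]
  have hinner : ∀ t : Fin s, ∑ ω : Fin s → B, ∑ u, iidWeight p ω * (D (ω t) * D (ω u))
      = ∑ b, p b * D b ^ 2 := by
    intro t
    rw [Finset.sum_comm, ← Finset.add_sum_erase _ _ (Finset.mem_univ t),
      Finset.sum_eq_zero (s := Finset.univ.erase t) (fun u hu => by
        rw [sum_iidWeight_mul_apply_mul_apply hp D D (Finset.ne_of_mem_erase hu).symm, hD,
          mul_zero]), add_zero]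
    simp only [← pow_two]
    exact sum_iidWeight_mul_apply hp (fun b => D b ^ 2) t
  simp only [hinner, Finset.sum_const, Finset.card_univ, Fintype.card_fin, nsmul_eq_mul]

/-- The centred second moment: `∑_b p(b) (Z(b) − μ)² = ∑_b p(b) Z(b)² − μ²` for `μ = ∑_b p(b) Z(b)`
("Since `Var[X_t] = E[X_t²] − E[X_t]²`"). [cite: DrineasKannanMahoney2006, §4.3, proof of Lemma 3] -/
theorem sum_mul_sq_sub_mean {p : B → ℝ} (hp : ∑ b, p b = 1) (Z : B → ℝ) :
    ∑ b, p b * (Z b - ∑ c, p c * Z c) ^ 2 = ∑ b, p b * Z b ^ 2 - (∑ c, p c * Z c) ^ 2 := by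
  set μ := ∑ c, p c * Z c with hμ
  have : ∀ b, p b * (Z b - μ) ^ 2 = p b * Z b ^ 2 - 2 * μ * (p b * Z b) + μ ^ 2 * p b := by
    intro b; ring
  simp only [this, Finset.sum_add_distrib, Finset.sum_sub_distrib, ← Finset.mul_sum, ← hμ, hp]
  ring

/-- **Variance of the empirical mean of `s` i.i.d. draws** is `1/s` times the single-draw
variance: `E[((1/s)∑_t Z(ω_t) − μ)²] = (∑_b p(b) (Z(b) − μ)²)/s` ("It suffices to consider `s = 1`,
because the variance of independent samples decreases as `1/s`").
[cite: ChiaEtAl2022, §5.2, proof of Lemma "Asymmetric matrix multiplication to Frobenius norm error"];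
[cite: DrineasKannanMahoney2006, §4.3, proof of Lemma 3] -/
theorem sum_iidWeight_mul_sq_avg_sub {p : B → ℝ} (hp : ∑ b, p b = 1) (Z : B → ℝ) (hs : s ≠ 0) :
    ∑ ω : Fin s → B, iidWeight p ω * ((∑ t, Z (ω t)) / s - ∑ c, p c * Z c) ^ 2
      = (∑ b, p b * (Z b - ∑ c, p c * Z c) ^ 2) / s := by
  set μ := ∑ c, p c * Z c with hμ
  have hs' : (s : ℝ) ≠ 0 := Nat.cast_ne_zero.2 hs
  have hD : ∑ b, p b * (Z b - μ) = 0 := by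
    simp only [mul_sub, Finset.sum_sub_distrib, ← Finset.sum_mul, hp, one_mul, ← hμ, sub_self]
  have hrw : ∀ ω : Fin s → B, ((∑ t, Z (ω t)) / s - μ) ^ 2
      = (∑ t, (Z (ω t) - μ)) ^ 2 / (s : ℝ) ^ 2 := by
    intro ω
    rw [Finset.sum_sub_distrib, Finset.sum_const, Finset.card_univ, Fintype.card_fin,
      nsmul_eq_mul]
    field_simp
  simp only [hrw, mul_div_assoc']
  rw [← Finset.sum_div, sum_iidWeight_mul_sq_sum hp (fun b => Z b - μ) hD]
  field_simp

end iid

/-! ### Row norms and the oversampling condition for matrices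

"We call them `φ`-oversampled importance sampling sketches if `p` comes from `SQ_φ(A)` (or, more
generally, from a `φ`-oversampled importance sampling distribution of `a`)", `a` the vector of row
norms [ChiaEtAl2022, §2.3 after Def. 2.12]; DKM06's form of the same hypothesis is eq. (46),
`p_k ≥ β‖A^{(k)}‖²/‖A‖_F²` with `β = 1/φ`. -/

section sketch

variable {m n q s : ℕ}

/-- `‖X‖_F² ≥ 0`. [cite: ChiaEtAl2022, §2.1 notation] -/
theorem frobSq_nonneg (X : Matrix (Fin m) (Fin n) ℝ) : 0 ≤ frobSq X :=
  sum_nonneg fun _ _ => normSq_nonneg _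

/-- The vector of row norms `a = (‖X(1,·)‖, …, ‖X(m,·)‖)`. [cite: ChiaEtAl2022, Def. 2.9] -/
def rowNorms (X : Matrix (Fin m) (Fin n) ℝ) : Fin m → ℝ := fun k => Real.sqrt (normSq (X k))

/-- `a(k)² = ‖X(k,·)‖²`. [cite: ChiaEtAl2022, Def. 2.9] -/
theorem rowNorms_sq (X : Matrix (Fin m) (Fin n) ℝ) (k : Fin m) : rowNorms X k ^ 2 = normSq (X k) :=
  Real.sq_sqrt (normSq_nonneg _)

/-- `𝒟_a = rowDist X`, i.e. `𝒟_a(k) = ‖X(k,·)‖²/‖X‖_F²`. [cite: ChiaEtAl2022, Def. 2.9] -/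
theorem lengthSqDist_rowNorms (X : Matrix (Fin m) (Fin n) ℝ) : lengthSqDist (rowNorms X) = rowDist X :=
  (rowDist_eq_lengthSqDist X).symm

/-- `‖a‖² = ‖X‖_F²`. [cite: ChiaEtAl2022, Def. 2.9] -/
theorem normSq_rowNorms (X : Matrix (Fin m) (Fin n) ℝ) : normSq (rowNorms X) = frobSq X :=
  (frobSq_eq_normSq_rowNorms X).symm

namespace IsOversampledDist

variable {φ : ℝ} {X : Matrix (Fin m) (Fin n) ℝ} {p : Fin m → ℝ}

/-- Under a `φ`-oversampled importance sampling distribution from `X`: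
`‖X(k,·)‖² ≤ φ ‖X‖_F² p(k)`, i.e. DKM06's condition (46) `p_k ≥ β‖A^{(k)}‖²/‖A‖_F²` with `β = 1/φ`.
[cite: ChiaEtAl2022, Def. 2.7 with Def. 2.12]; [cite: DrineasKannanMahoney2006, App. A.3, Lemma 8, eq. (46)] -/
theorem normSq_row_le (h : IsOversampledDist φ (rowNorms X) p) (hφ : 0 < φ) (k : Fin m) :
    normSq (X k) ≤ φ * frobSq X * p k := by
  have hk := h.div_le k
  rw [lengthSqDist_rowNorms] at hk
  unfold rowDist at hk
  rcases eq_or_ne (frobSq X) 0 with h0 | h0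
  · have hrow : normSq (X k) = 0 := by
      have hle : normSq (X k) ≤ frobSq X :=
        Finset.single_le_sum (f := fun i => normSq (X i)) (fun i _ => normSq_nonneg _)
          (Finset.mem_univ k)
      exact le_antisymm (h0 ▸ hle) (normSq_nonneg _)
    rw [hrow, h0]; simp
  · have hF : 0 < frobSq X := lt_of_le_of_ne (frobSq_nonneg X) (Ne.symm h0)
    rw [div_div, div_le_iff₀ (mul_pos hF hφ)] at hk
    nlinarith [hk]

/-- `p(k) = 0` forces the row `X(k,·)` to vanish (so mass-zero indices carry no term of `XᵀY`).
[cite: ChiaEtAl2022, Def. 2.7 with Def. 2.12] -/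
theorem row_eq_zero (h : IsOversampledDist φ (rowNorms X) p) (hφ : 0 < φ) {k : Fin m}
    (hk : p k = 0) : X k = 0 := by
  have := h.normSq_row_le hφ k
  rw [hk, mul_zero] at this
  exact (normSq_eq_zero_iff _).1 (le_antisymm this (normSq_nonneg _))

/-- `‖X(k,·)‖²/p(k) ≤ φ‖X‖_F²` (junk value `x/0 = 0` included) — the pointwise bound used in the last
step of both proofs ("`≤ φ‖X‖_F²‖Y‖_F²`"). [cite: ChiaEtAl2022, §5.2, proof of Lemma "Asymmetric
matrix multiplication to Frobenius norm error"]; [cite: DrineasKannanMahoney2006, App. A.3, eq. (46)] -/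
theorem normSq_row_div_le (h : IsOversampledDist φ (rowNorms X) p) (hφ : 0 < φ) (k : Fin m) :
    normSq (X k) / p k ≤ φ * frobSq X := by
  rcases (h.nonneg k).eq_or_lt with hk | hk
  · rw [← hk, div_zero]; exact mul_nonneg hφ.le (frobSq_nonneg X)
  · rw [div_le_iff₀ hk]; exact h.normSq_row_le hφ k

end IsOversampledDist

/-! ### Importance sampling sketches (Def. 2.12) and the sketched product `XᵀSᵀSY` -/

/-- The sketch `S ∈ ℝ^{s×m}` "sampled according to `p`" along the sample sequence `ω`: row `t` of
`S` is `e_{ω_t}/√(s·p(ω_t))` (DKM06: `(SD)ᵀ` with `D_tt = 1/√(c p_{i_t})`).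
[cite: ChiaEtAl2022, Def. 2.12]; [cite: DrineasKannanMahoney2006, §4.1 (sampling matrix `S`, rescaling `D`)] -/
def sketch (p : Fin m → ℝ) (ω : Fin s → Fin m) : Matrix (Fin s) (Fin m) ℝ :=
  fun t k => if k = ω t then 1 / Real.sqrt (s * p k) else 0

/-- Row `t` of `SX` is the rescaled sampled row: `[SX](t,·) = X(ω_t,·)/√(s p(ω_t))` ("it is a
normalized multiset of rows of `A`"). [cite: ChiaEtAl2022, Remark 2.13 and §2.3];
[cite: DrineasKannanMahoney2006, §4.1 Fig. 2 step 1(b) (`R_{(t)} = B_{(i_t)}/√(c p_{i_t})`)] -/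
theorem sketch_mul_apply (p : Fin m → ℝ) (ω : Fin s → Fin m) (X : Matrix (Fin m) (Fin n) ℝ)
    (t : Fin s) (j : Fin n) :
    (sketch p ω * X) t j = X (ω t) j / Real.sqrt (s * p (ω t)) := by
  rw [Matrix.mul_apply]
  simp only [sketch, ite_mul, zero_mul, Finset.sum_ite_eq', Finset.mem_univ, if_true]
  ring

/-- `‖[SX](t,·)‖² = ‖X(ω_t,·)‖²/(s·p(ω_t))` ("`‖[SA](i,·)‖ = ‖A(s_i,·)‖/√(s·p(i))`" — the printed
`p(i)` is `p(s_i)`). [cite: ChiaEtAl2022, Remark 2.13] -/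
theorem normSq_sketch_mul_row {p : Fin m → ℝ} (hp : ∀ k, 0 ≤ p k) (ω : Fin s → Fin m)
    (X : Matrix (Fin m) (Fin n) ℝ) (t : Fin s) :
    normSq ((sketch p ω * X) t) = normSq (X (ω t)) / (s * p (ω t)) := by
  have h0 : (0 : ℝ) ≤ s * p (ω t) := mul_nonneg (Nat.cast_nonneg _) (hp _)
  unfold normSq
  simp only [sketch_mul_apply, div_pow, Real.sq_sqrt h0]
  rw [Finset.sum_div]

/-- The single-sample estimator: having drawn row index `k`, output the rank-one matrix
`X(k,·)ᵀ Y(k,·)/p(k)` ("randomly sample … from the terms in the summation (3) … scale each term";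
`c = 1`). [cite: DrineasKannanMahoney2006, §4.1, eq. (3) and Fig. 2]; [cite: ChiaEtAl2022, §3.2
("approximate the matrix product `A†B` by a sum of rank-one outer products")] -/
def outerEst (X : Matrix (Fin m) (Fin n) ℝ) (Y : Matrix (Fin m) (Fin q) ℝ) (p : Fin m → ℝ)
    (k : Fin m) : Matrix (Fin n) (Fin q) ℝ :=
  fun i j => X k i * Y k j / p k

/-- `XᵀSᵀSY = (SX)ᵀ(SY)` is the average of the `s` single-sample estimators along `ω`:
`CR = ∑_{t=1}^c A^{(i_t)}B_{(i_t)}/(c p_{i_t})`. [cite: DrineasKannanMahoney2006, §4.1 (display after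
Fig. 2)]; [cite: ChiaEtAl2022, Def. 2.12 ("One should think of `S` as sketching `A` down to `SA`")] -/
theorem sketch_transpose_mul_sketch {p : Fin m → ℝ} (hp : ∀ k, 0 ≤ p k) (ω : Fin s → Fin m)
    (X : Matrix (Fin m) (Fin n) ℝ) (Y : Matrix (Fin m) (Fin q) ℝ) (i : Fin n) (j : Fin q) :
    ((sketch p ω * X)ᵀ * (sketch p ω * Y)) i j = (∑ t, outerEst X Y p (ω t) i j) / s := by
  rw [Matrix.mul_apply, Finset.sum_div]
  refine Finset.sum_congr rfl fun t _ => ?_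
  have h0 : (0 : ℝ) ≤ s * p (ω t) := mul_nonneg (Nat.cast_nonneg _) (hp _)
  simp only [Matrix.transpose_apply, sketch_mul_apply, outerEst]
  rw [div_mul_div_comm, Real.mul_self_sqrt h0, div_div, mul_comm (p _)]

/-! ### Unbiasedness and the exact mean squared Frobenius error (DKM06 Lemmas 3–4) -/

section moments

variable {p : Fin m → ℝ} {X : Matrix (Fin m) (Fin n) ℝ} {Y : Matrix (Fin m) (Fin q) ℝ}

/-- Single-sample mean: `∑_k p(k) · X(k,i)Y(k,j)/p(k) = (XᵀY)_{ij}`, provided no mass-zero index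
carries a nonzero term ("`E[X_t] = ∑_k p_k A_{ik}B_{kj}/(c p_k) = (1/c)(AB)_{ij}`", `c = 1`).
[cite: DrineasKannanMahoney2006, §4.3, proof of Lemma 3] -/
theorem sum_mul_outerEst (hsupp : ∀ k, p k = 0 → X k = 0 ∨ Y k = 0) (i : Fin n) (j : Fin q) :
    ∑ k, p k * outerEst X Y p k i j = (Xᵀ * Y) i j := by
  rw [Matrix.mul_apply]
  refine Finset.sum_congr rfl fun k _ => ?_
  simp only [outerEst, Matrix.transpose_apply]
  rcases eq_or_ne (p k) 0 with h0 | h0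
  · rcases hsupp k h0 with h | h <;> simp [h0, h]
  · field_simp

/-- Single-sample second moment: `∑_k p(k) (X(k,i)Y(k,j)/p(k))² = ∑_k X(k,i)²Y(k,j)²/p(k)`
("`E[X_t²] = ∑_k A_{ik}²B_{kj}²/(c²p_k)`", `c = 1`). [cite: DrineasKannanMahoney2006, §4.3, proof of Lemma 3] -/
theorem sum_mul_outerEst_sq (p : Fin m → ℝ) (X : Matrix (Fin m) (Fin n) ℝ)
    (Y : Matrix (Fin m) (Fin q) ℝ) (i : Fin n) (j : Fin q) :
    ∑ k, p k * outerEst X Y p k i j ^ 2 = ∑ k, X k i ^ 2 * Y k j ^ 2 / p k := by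
  refine Finset.sum_congr rfl fun k _ => ?_
  simp only [outerEst]
  rcases eq_or_ne (p k) 0 with h0 | h0
  · simp [h0]
  · field_simp

/-- **DKM06 Lemma 3, mean**: `E[(CR)_{ij}] = (AB)_{ij}`, i.e. `E[XᵀSᵀSY] = XᵀY` entrywise
("`A†S†SB` is an unbiased estimator for `A†B`"). [cite: DrineasKannanMahoney2006, §4.3, Lemma 3];
[cite: ChiaEtAl2022, §5.2 ("Since `E[S†S] = I`, we have `E[X†S†SY] = X†Y`")] -/
theorem iid_mean_sketchProd (hp0 : ∀ k, 0 ≤ p k) (hp1 : ∑ k, p k = 1)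
    (hsupp : ∀ k, p k = 0 → X k = 0 ∨ Y k = 0) (hs : s ≠ 0) (i : Fin n) (j : Fin q) :
    ∑ ω : Fin s → Fin m, iidWeight p ω * ((sketch p ω * X)ᵀ * (sketch p ω * Y)) i j
      = (Xᵀ * Y) i j := by
  have hs' : (s : ℝ) ≠ 0 := Nat.cast_ne_zero.2 hs
  simp only [sketch_transpose_mul_sketch hp0, mul_div_assoc', Finset.mul_sum]
  rw [← Finset.sum_div, Finset.sum_comm]
  simp only [sum_iidWeight_mul_apply hp1 (fun k => outerEst X Y p k i j), sum_mul_outerEst hsupp,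
    Finset.sum_const, Finset.card_univ, Fintype.card_fin, nsmul_eq_mul]
  field_simp

/-- **DKM06 Lemma 3, variance** (`c = s` samples):
`Var[(CR)_{ij}] = (1/c) ∑_k A_{ik}²B_{kj}²/p_k − (1/c)(AB)_{ij}²`, here
`E[((XᵀSᵀSY)_{ij} − (XᵀY)_{ij})²] = ((∑_k X(k,i)²Y(k,j)²/p(k)) − (XᵀY)_{ij}²)/s`.
[cite: DrineasKannanMahoney2006, §4.3, Lemma 3] -/
theorem iid_var_sketchProd_entry (hp0 : ∀ k, 0 ≤ p k) (hp1 : ∑ k, p k = 1)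
    (hsupp : ∀ k, p k = 0 → X k = 0 ∨ Y k = 0) (hs : s ≠ 0) (i : Fin n) (j : Fin q) :
    ∑ ω : Fin s → Fin m, iidWeight p ω *
        (((sketch p ω * X)ᵀ * (sketch p ω * Y)) i j - (Xᵀ * Y) i j) ^ 2
      = ((∑ k, X k i ^ 2 * Y k j ^ 2 / p k) - (Xᵀ * Y) i j ^ 2) / s := by
  simp only [sketch_transpose_mul_sketch hp0]
  rw [← sum_mul_outerEst hsupp i j, sum_iidWeight_mul_sq_avg_sub hp1 (fun k => outerEst X Y p k i j) hs,
    sum_mul_sq_sub_mean hp1, sum_mul_outerEst_sq]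

/-- Bookkeeping: `∑_{i,j} ∑_k X(k,i)²Y(k,j)²/p(k) = ∑_k ‖X(k,·)‖²‖Y(k,·)‖²/p(k)`
("`(1/c)∑_k (1/p_k)(∑_i A_{ik}²)(∑_j B_{kj}²)`"). [cite: DrineasKannanMahoney2006, §4.3, proof of Lemma 4] -/
theorem sum_sum_sum_sq_mul_sq_div (p : Fin m → ℝ) (X : Matrix (Fin m) (Fin n) ℝ)
    (Y : Matrix (Fin m) (Fin q) ℝ) :
    ∑ i, ∑ j, ∑ k, X k i ^ 2 * Y k j ^ 2 / p k = ∑ k, normSq (X k) * normSq (Y k) / p k := by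
  unfold normSq
  simp only [Finset.sum_mul_sum, Finset.sum_div]
  symm
  rw [Finset.sum_comm (f := fun k i => ∑ j, X k i ^ 2 * Y k j ^ 2 / p k)]
  refine Finset.sum_congr rfl fun i _ => ?_
  exact Finset.sum_comm

/-- `‖M − N‖_F² = ∑_{ij} (M_{ij} − N_{ij})²` ("`E‖AB − CR‖_F² = ∑_i∑_j E[(AB − CR)_{ij}²]`").
[cite: DrineasKannanMahoney2006, §4.3, proof of Lemma 4] -/
theorem frobSq_sub (M N : Matrix (Fin n) (Fin q) ℝ) :
    frobSq (M - N) = ∑ i, ∑ j, (M i j - N i j) ^ 2 := by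
  rw [frobSq_eq_sum_sq]; rfl

/-- **DKM06 Lemma 4, eq. (4)** (exact mean squared Frobenius error, arbitrary probabilities):
`E‖AB − CR‖_F² = (1/c)∑_k ‖A^{(k)}‖²‖B_{(k)}‖²/p_k − (1/c)‖AB‖_F²`, here
`E‖XᵀSᵀSY − XᵀY‖_F² = ((∑_k ‖X(k,·)‖²‖Y(k,·)‖²/p(k)) − ‖XᵀY‖_F²)/s`.
[cite: DrineasKannanMahoney2006, §4.3, Lemma 4, eq. (4)] -/
theorem iid_frobSq_sub (hp0 : ∀ k, 0 ≤ p k) (hp1 : ∑ k, p k = 1)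
    (hsupp : ∀ k, p k = 0 → X k = 0 ∨ Y k = 0) (hs : s ≠ 0) :
    ∑ ω : Fin s → Fin m, iidWeight p ω * frobSq ((sketch p ω * X)ᵀ * (sketch p ω * Y) - Xᵀ * Y)
      = ((∑ k, normSq (X k) * normSq (Y k) / p k) - frobSq (Xᵀ * Y)) / s := by
  simp only [frobSq_sub, Finset.mul_sum]
  rw [Finset.sum_comm]
  have hswap : ∀ i : Fin n, ∑ ω : Fin s → Fin m, ∑ j : Fin q, iidWeight p ω *
      (((sketch p ω * X)ᵀ * (sketch p ω * Y)) i j - (Xᵀ * Y) i j) ^ 2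
      = ∑ j : Fin q, (((∑ k, X k i ^ 2 * Y k j ^ 2 / p k) - (Xᵀ * Y) i j ^ 2) / s) := by
    intro i
    rw [Finset.sum_comm]
    exact Finset.sum_congr rfl fun j _ => iid_var_sketchProd_entry hp0 hp1 hsupp hs i j
  simp only [hswap, ← Finset.sum_div, Finset.sum_sub_distrib, sum_sum_sum_sq_mul_sq_div,
    frobSq_eq_sum_sq]

end moments

/-! ### The `φ/s` bounds (CGLLTW Lemma "Asymmetric matrix multiplication …" = DKM06 Lemma 8) -/

section bounds

variable {φ : ℝ} {p : Fin m → ℝ} {X : Matrix (Fin m) (Fin n) ℝ}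

/-- `∑_k ‖X(k,·)‖²‖Y(k,·)‖²/p(k) ≤ φ‖X‖_F²‖Y‖_F²` when `p` is `φ`-oversampled from `X` (the last
line of the printed proof). [cite: ChiaEtAl2022, §5.2, proof of Lemma "Asymmetric matrix multiplication
to Frobenius norm error"]; [cite: DrineasKannanMahoney2006, App. A.3, Lemma 8] -/
theorem sum_normSq_mul_normSq_div_le (h : IsOversampledDist φ (rowNorms X) p) (hφ : 0 < φ)
    (Y : Matrix (Fin m) (Fin q) ℝ) :
    ∑ k, normSq (X k) * normSq (Y k) / p k ≤ φ * frobSq X * frobSq Y := by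
  calc ∑ k, normSq (X k) * normSq (Y k) / p k = ∑ k, normSq (X k) / p k * normSq (Y k) :=
        Finset.sum_congr rfl fun k _ => by ring
    _ ≤ ∑ k, φ * frobSq X * normSq (Y k) :=
        Finset.sum_le_sum fun k _ =>
          mul_le_mul_of_nonneg_right (h.normSq_row_div_le hφ k) (normSq_nonneg _)
    _ = φ * frobSq X * frobSq Y := by rw [← Finset.mul_sum]; rfl

/-- The same bound when `p` is `φ`-oversampled from `Y` instead ("from `X` or `Y`").
[cite: ChiaEtAl2022, §3.2, Lemma "Asymmetric matrix multiplication to Frobenius norm error"] -/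
theorem sum_normSq_mul_normSq_div_le' {Y : Matrix (Fin m) (Fin q) ℝ}
    (h : IsOversampledDist φ (rowNorms Y) p) (hφ : 0 < φ) (X : Matrix (Fin m) (Fin n) ℝ) :
    ∑ k, normSq (X k) * normSq (Y k) / p k ≤ φ * frobSq X * frobSq Y := by
  calc ∑ k, normSq (X k) * normSq (Y k) / p k = ∑ k, normSq (X k) * (normSq (Y k) / p k) :=
        Finset.sum_congr rfl fun k _ => by ring
    _ ≤ ∑ k, normSq (X k) * (φ * frobSq Y) :=
        Finset.sum_le_sum fun k _ =>
          mul_le_mul_of_nonneg_left (h.normSq_row_div_le hφ k) (normSq_nonneg _)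
    _ = φ * frobSq X * frobSq Y := by rw [← Finset.sum_mul]; unfold frobSq; ring

/-- **Asymmetric approximate matrix product, first inequality** (`p` a `φ`-oversampled importance
sampling distribution from `X`, `s ≥ 1` samples): `E[‖XᵀSᵀSY − XᵀY‖_F²] ≤ (φ/s)‖X‖_F²‖Y‖_F²`;
equivalently DKM06 Lemma 8, eq. (47): `E‖AB − CR‖_F² ≤ ‖A‖_F²‖B‖_F²/(βc)` under (46) with `β = 1/φ`.
[cite: ChiaEtAl2022, §3.2, Lemma "Asymmetric matrix multiplication to Frobenius norm error [DKM06]"];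
[cite: DrineasKannanMahoney2006, App. A.3, Lemma 8, eq. (47)] -/
theorem iid_frobSq_sub_le (h : IsOversampledDist φ (rowNorms X) p) (hφ : 0 < φ) (hs : s ≠ 0)
    (Y : Matrix (Fin m) (Fin q) ℝ) :
    ∑ ω : Fin s → Fin m, iidWeight p ω * frobSq ((sketch p ω * X)ᵀ * (sketch p ω * Y) - Xᵀ * Y)
      ≤ φ / s * (frobSq X * frobSq Y) := by
  rw [iid_frobSq_sub h.nonneg h.sum_eq_one (fun k hk => Or.inl (h.row_eq_zero hφ hk)) hs]
  have hs' : (0 : ℝ) < s := by positivity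
  have h1 := sum_normSq_mul_normSq_div_le h hφ Y
  have h2 := frobSq_nonneg (Xᵀ * Y)
  rw [div_mul_eq_mul_div, div_le_div_iff_of_pos_right hs']
  linarith

/-- **First inequality, `p` oversampled from `Y`** ("from `X` or `Y`"):
`E[‖XᵀSᵀSY − XᵀY‖_F²] ≤ (φ/s)‖X‖_F²‖Y‖_F²`.
[cite: ChiaEtAl2022, §3.2, Lemma "Asymmetric matrix multiplication to Frobenius norm error [DKM06]"] -/
theorem iid_frobSq_sub_le' {Y : Matrix (Fin m) (Fin q) ℝ} (h : IsOversampledDist φ (rowNorms Y) p)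
    (hφ : 0 < φ) (hs : s ≠ 0) (X : Matrix (Fin m) (Fin n) ℝ) :
    ∑ ω : Fin s → Fin m, iidWeight p ω * frobSq ((sketch p ω * X)ᵀ * (sketch p ω * Y) - Xᵀ * Y)
      ≤ φ / s * (frobSq X * frobSq Y) := by
  rw [iid_frobSq_sub h.nonneg h.sum_eq_one (fun k hk => Or.inr (h.row_eq_zero hφ hk)) hs]
  have hs' : (0 : ℝ) < s := by positivity
  have h1 := sum_normSq_mul_normSq_div_le' h hφ X
  have h2 := frobSq_nonneg (Xᵀ * Y)
  rw [div_mul_eq_mul_div, div_le_div_iff_of_pos_right hs']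
  linarith

/-- **Second inequality, exact form of the printed proof**:
`E[∑_t ‖[SX](t,·)‖²‖[SY](t,·)‖²] = s ∑_k p(k) ‖X(k,·)‖²‖Y(k,·)‖²/(s²p(k)²)`.
[cite: ChiaEtAl2022, §5.2, proof of Lemma "Asymmetric matrix multiplication to Frobenius norm error"
("The second inequality follows similarly")] -/
theorem iid_sum_normSq_row_mul (hp0 : ∀ k, 0 ≤ p k) (hp1 : ∑ k, p k = 1)
    (Y : Matrix (Fin m) (Fin q) ℝ) :
    ∑ ω : Fin s → Fin m, iidWeight p ω *
        ∑ t, normSq ((sketch p ω * X) t) * normSq ((sketch p ω * Y) t)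
      = s * ∑ k, p k * (normSq (X k) * normSq (Y k) / ((s : ℝ) ^ 2 * p k ^ 2)) := by
  simp only [normSq_sketch_mul_row hp0, Finset.mul_sum]
  rw [Finset.sum_comm]
  have : ∀ t : Fin s, ∑ ω : Fin s → Fin m, iidWeight p ω *
      (normSq (X (ω t)) / (s * p (ω t)) * (normSq (Y (ω t)) / (s * p (ω t))))
      = ∑ k, p k * (normSq (X k) * normSq (Y k) / ((s : ℝ) ^ 2 * p k ^ 2)) := by
    intro t
    rw [sum_iidWeight_mul_apply hp1 (fun k => normSq (X k) / (s * p k) * (normSq (Y k) / (s * p k))) t]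
    refine Finset.sum_congr rfl fun k _ => ?_
    rw [div_mul_div_comm]
    congr 1; ring
  simp only [this, Finset.sum_const, Finset.card_univ, Fintype.card_fin, nsmul_eq_mul]
  rw [Finset.mul_sum]

/-- **Asymmetric approximate matrix product, second inequality** (`p` oversampled from `X`):
`E[∑_{t=1}^s ‖[SX](t,·)‖²‖[SY](t,·)‖²] ≤ (φ/s)‖X‖_F²‖Y‖_F²`.
[cite: ChiaEtAl2022, §3.2, Lemma "Asymmetric matrix multiplication to Frobenius norm error [DKM06]"] -/
theorem iid_sum_normSq_row_mul_le (h : IsOversampledDist φ (rowNorms X) p) (hφ : 0 < φ)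
    (hs : s ≠ 0) (Y : Matrix (Fin m) (Fin q) ℝ) :
    ∑ ω : Fin s → Fin m, iidWeight p ω *
        ∑ t, normSq ((sketch p ω * X) t) * normSq ((sketch p ω * Y) t)
      ≤ φ / s * (frobSq X * frobSq Y) := by
  rw [iid_sum_normSq_row_mul h.nonneg h.sum_eq_one]
  have hs' : (0 : ℝ) < s := by positivity
  have hterm : ∀ k, p k * (normSq (X k) * normSq (Y k) / ((s : ℝ) ^ 2 * p k ^ 2))
      = (normSq (X k) * normSq (Y k) / p k) / (s : ℝ) ^ 2 := by
    intro k
    rcases eq_or_ne (p k) 0 with h0 | h0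
    · simp [h0]
    · field_simp
  simp only [hterm, ← Finset.sum_div]
  have h1 := sum_normSq_mul_normSq_div_le h hφ Y
  calc (s : ℝ) * ((∑ k, normSq (X k) * normSq (Y k) / p k) / (s : ℝ) ^ 2)
      = (∑ k, normSq (X k) * normSq (Y k) / p k) / s := by field_simp
    _ ≤ (φ * frobSq X * frobSq Y) / s := div_le_div_of_nonneg_right h1 hs'.le
    _ = φ / s * (frobSq X * frobSq Y) := by ring

/-! ### Deterministic and mean Frobenius norms of a sketch (Remark 2.13, Lemma 5.1) -/

/-- `‖[SX](t,·)‖² ≤ (φ/s)‖X‖_F²` ("`‖[SA](i,·)‖ ≤ √(φ/s)‖A‖_F`"; Lemma 5.1: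
"`r‖[SA](i,·)‖² = ‖A(s_i,·)‖²/p(s_i) ≤ φ‖A‖_F²`"). [cite: ChiaEtAl2022, Remark 2.13];
[cite: ChiaEtAl2022, §5.2, proof of Lemma 5.1] -/
theorem normSq_sketch_mul_row_le (h : IsOversampledDist φ (rowNorms X) p) (hφ : 0 < φ)
    (ω : Fin s → Fin m) (t : Fin s) :
    normSq ((sketch p ω * X) t) ≤ φ / s * frobSq X := by
  rw [normSq_sketch_mul_row h.nonneg]
  have hs' : (0 : ℝ) < s := Nat.cast_pos.2 t.pos
  rw [mul_comm (s : ℝ), ← div_div]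
  calc normSq (X (ω t)) / p (ω t) / s ≤ φ * frobSq X / s :=
        div_le_div_of_nonneg_right (h.normSq_row_div_le hφ _) hs'.le
    _ = φ / s * frobSq X := by ring

/-- "When `φ = 1`, these inequalities are equalities": for the exact importance sampling
distribution `p = 𝒟_a = rowDist X` and a sampled row of positive mass,
`‖[SX](t,·)‖² = ‖X‖_F²/s`. [cite: ChiaEtAl2022, Remark 2.13] -/
theorem normSq_sketch_mul_row_eq (X : Matrix (Fin m) (Fin n) ℝ) (ω : Fin s → Fin m) (t : Fin s)
    (hpos : 0 < rowDist X (ω t)) :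
    normSq ((sketch (rowDist X) ω * X) t) = frobSq X / s := by
  have hp0 : ∀ k, 0 ≤ rowDist X k := fun k =>
    div_nonneg (normSq_nonneg _) (frobSq_nonneg X)
  rw [normSq_sketch_mul_row hp0]
  have hF : frobSq X ≠ 0 := by
    intro h0; simp [rowDist, h0] at hpos
  have hrow : normSq (X (ω t)) ≠ 0 := by
    intro h0; simp [rowDist, h0] at hpos
  unfold rowDist
  field_simp

/-- `‖SX‖_F² ≤ φ‖X‖_F²` "(always)" ("consequently, `‖SA‖_F ≤ √φ‖A‖_F`").
[cite: ChiaEtAl2022, Lemma 5.1 (first clause)]; [cite: ChiaEtAl2022, Remark 2.13] -/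
theorem frobSq_sketch_mul_le (h : IsOversampledDist φ (rowNorms X) p) (hφ : 0 < φ)
    (ω : Fin s → Fin m) : frobSq (sketch p ω * X) ≤ φ * frobSq X := by
  rcases Nat.eq_zero_or_pos s with hs | hs
  · subst hs
    unfold frobSq
    rw [Finset.univ_eq_empty, Finset.sum_empty]
    exact mul_nonneg hφ.le (frobSq_nonneg X)
  · have hs' : (0 : ℝ) < s := Nat.cast_pos.2 hs
    unfold frobSq
    calc ∑ t, normSq ((sketch p ω * X) t) ≤ ∑ _t : Fin s, φ / s * frobSq X :=
          Finset.sum_le_sum fun t _ => normSq_sketch_mul_row_le h hφ ω t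
      _ = φ * frobSq X := by
          rw [Finset.sum_const, Finset.card_univ, Fintype.card_fin, nsmul_eq_mul]
          field_simp

/-- `E‖SX‖_F² = ‖X‖_F²` ("`‖SA‖_F²` is the average of … `r‖[SA](i,·)‖²` … and
`E[r‖[SA](i,·)‖²] = r∑_s p(s)‖A(s,·)‖²/(r p(s)) = ‖A‖_F²`").
[cite: ChiaEtAl2022, §5.2, proof of Lemma 5.1] -/
theorem iid_frobSq_sketch_mul (hp0 : ∀ k, 0 ≤ p k) (hp1 : ∑ k, p k = 1)
    (hsupp : ∀ k, p k = 0 → X k = 0) (hs : s ≠ 0) :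
    ∑ ω : Fin s → Fin m, iidWeight p ω * frobSq (sketch p ω * X) = frobSq X := by
  have hs' : (s : ℝ) ≠ 0 := Nat.cast_ne_zero.2 hs
  unfold frobSq
  simp only [normSq_sketch_mul_row hp0, Finset.mul_sum]
  rw [Finset.sum_comm]
  have hrow : ∀ t : Fin s, ∑ ω : Fin s → Fin m, iidWeight p ω * (normSq (X (ω t)) / (s * p (ω t)))
      = (∑ k, normSq (X k)) / s := by
    intro t
    rw [sum_iidWeight_mul_apply hp1 (fun k => normSq (X k) / (s * p k)) t, Finset.sum_div]
    refine Finset.sum_congr rfl fun k _ => ?_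
    rcases eq_or_ne (p k) 0 with h0 | h0
    · have : normSq (X k) = 0 := by rw [hsupp k h0]; exact (normSq_eq_zero_iff _).2 rfl
      simp [h0, this]
    · field_simp
  simp only [hrow, Finset.sum_const, Finset.card_univ, Fintype.card_fin, nsmul_eq_mul]
  field_simp

/-! ### Markov / Chebyshev form

"We formalize this with two variance bounds, which we can use together with Chebyshev's
inequality" [ChiaEtAl2022, §3.2]. -/

/-- Weighted Markov inequality on a finite sample space: `a · w{f ≥ a} ≤ ∑ w·f` for `w, f ≥ 0`.
[cite: AroraBarak2009, Lemma A.12 (Markov/Chebyshev)] -/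
theorem mul_sum_filter_le_sum_mul {ι : Type*} [Fintype ι] (w f : ι → ℝ) (hw : ∀ i, 0 ≤ w i)
    (hf : ∀ i, 0 ≤ f i) (a : ℝ) [DecidablePred fun i => a ≤ f i] :
    a * ∑ i ∈ Finset.univ.filter (fun i => a ≤ f i), w i ≤ ∑ i, w i * f i := by
  rw [Finset.mul_sum]
  calc ∑ i ∈ Finset.univ.filter (fun i => a ≤ f i), a * w i
      ≤ ∑ i ∈ Finset.univ.filter (fun i => a ≤ f i), w i * f i :=
        Finset.sum_le_sum fun i hi => by
          rw [mul_comm]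
          exact mul_le_mul_of_nonneg_left (Finset.mem_filter.1 hi).2 (hw i)
    _ ≤ ∑ i, w i * f i :=
        Finset.sum_le_sum_of_subset_of_nonneg (Finset.filter_subset _ _)
          fun i _ _ => mul_nonneg (hw i) (hf i)

/-- **Chebyshev form of the first inequality**: the `p`-mass of the sample sequences `ω ∈ [m]^s`
with `‖XᵀSᵀSY − XᵀY‖_F² ≥ a` is at most `(φ/s)‖X‖_F²‖Y‖_F²/a` (`a > 0`); with
`a = ε²‖X‖_F²‖Y‖_F²` this is failure probability `≤ φ/(sε²)`, i.e. `s = O(φ/(ε²δ))` samples for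
`‖XᵀSᵀSY − XᵀY‖_F ≤ ε‖X‖_F‖Y‖_F` with probability `≥ 1 − δ`.
[cite: ChiaEtAl2022, §3.2 ("which we can use together with Chebyshev's inequality")];
[cite: DrineasKannanMahoney2006, §4.3 (Jensen/Markov remarks before Lemma 3)] -/
theorem iid_mass_frobSq_sub_ge_le (h : IsOversampledDist φ (rowNorms X) p) (hφ : 0 < φ)
    (hs : s ≠ 0) (Y : Matrix (Fin m) (Fin q) ℝ) {a : ℝ} (ha : 0 < a) :
    ∑ ω ∈ Finset.univ.filter (fun ω : Fin s → Fin m =>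
        a ≤ frobSq ((sketch p ω * X)ᵀ * (sketch p ω * Y) - Xᵀ * Y)), iidWeight p ω
      ≤ φ / s * (frobSq X * frobSq Y) / a := by
  rw [le_div_iff₀ ha, mul_comm]
  exact (mul_sum_filter_le_sum_mul _ _ (iidWeight_nonneg h.nonneg) (fun ω => frobSq_nonneg _) a).trans
    (iid_frobSq_sub_le h hφ hs Y)

end bounds

end sketch

/-! ### DKM06 Lemma 4, eqs. (5)–(6): the optimal probabilities and their optimality

[cite: DrineasKannanMahoney2006, §4.3, Lemma 4, p. 141, eqs. (5)–(6) and the sentence "This choice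
of `p_k` minimizes `E[‖AB − CR‖_F²]` among possible choices for the sampling probabilities"; proof
pp. 141–142].  DKM06 prove the optimality with the Lagrangian of
`f(p₁,…,p_n) = ∑_k ‖A^{(k)}‖²‖B_{(k)}‖²/p_k` on the simplex; here the same inequality
`(∑_k a_k)² ≤ ∑_k a_k²/p_k` is obtained in one line from Cauchy–Schwarz (`sq_sum_le_sum_sq_div`),
a shorter road to the printed statement. -/

section optimal

variable {m n q s : ℕ}

/-- Cauchy–Schwarz form of DKM06's optimality statement: for any probability vector `p` that is
positive wherever `a_k ≠ 0`, `(∑_k a_k)² ≤ ∑_k a_k²/p_k`.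
[cite: DrineasKannanMahoney2006, §4.3, proof of Lemma 4, pp. 141–142 (the minimum of
`∑_k a_k²/p_k` over the simplex is `(∑_k a_k)²`; there via a Lagrange multiplier)] -/
theorem sq_sum_le_sum_sq_div {ι : Type*} [Fintype ι] (a p : ι → ℝ) (hp0 : ∀ k, 0 ≤ p k)
    (hp1 : ∑ k, p k = 1) (hsupp : ∀ k, p k = 0 → a k = 0) :
    (∑ k, a k) ^ 2 ≤ ∑ k, a k ^ 2 / p k := by
  have hcs := Finset.sum_mul_sq_le_sq_mul_sq (Finset.univ : Finset ι)
    (fun k => a k / Real.sqrt (p k)) (fun k => Real.sqrt (p k))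
  have h1 : ∀ k, a k / Real.sqrt (p k) * Real.sqrt (p k) = a k := by
    intro k
    rcases (hp0 k).eq_or_lt with h0 | hpos
    · rw [← h0, hsupp k h0.symm]; simp
    · field_simp
  have h2 : ∀ k, (a k / Real.sqrt (p k)) ^ 2 = a k ^ 2 / p k := by
    intro k; rw [div_pow, Real.sq_sqrt (hp0 k)]
  have h3 : ∀ k, Real.sqrt (p k) ^ 2 = p k := fun k => Real.sq_sqrt (hp0 k)
  simp only [h1, h2, h3, hp1, mul_one] at hcs
  exact hcs

/-- With DKM06's optimal probabilities `p_k = a_k / ∑_l a_l` (`∑ a > 0`):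
`∑_k a_k²/p_k = (∑_k a_k)²`.
[cite: DrineasKannanMahoney2006, §4.3, Lemma 4, eq. (5) ⇒ (6) (substituting the optimal `p_k`
into eq. (4))] -/
theorem sum_sq_div_optimal {ι : Type*} [Fintype ι] (a p : ι → ℝ)
    (hA : 0 < ∑ l, a l) (hp : ∀ k, p k = a k / ∑ l, a l) :
    ∑ k, a k ^ 2 / p k = (∑ k, a k) ^ 2 := by
  have hterm : ∀ k, a k ^ 2 / p k = a k * ∑ l, a l := by
    intro k
    rw [hp k]
    rcases eq_or_ne (a k) 0 with h0 | h0
    · simp [h0]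
    · field_simp
  rw [Finset.sum_congr rfl fun k _ => hterm k, ← Finset.sum_mul, sq]

variable {X : Matrix (Fin m) (Fin n) ℝ} {Y : Matrix (Fin m) (Fin q) ℝ} {p : Fin m → ℝ}

/-- `‖X(k,·)‖²‖Y(k,·)‖² = (‖X(k,·)‖‖Y(k,·)‖)²` in terms of `rowNorms` (DKM06's `|A^{(k)}|²|B_{(k)}|²
= (|A^{(k)}||B_{(k)}|)²`). [cite: DrineasKannanMahoney2006, §4.3, Lemma 4, eqs. (4)–(6) notation] -/
theorem normSq_mul_normSq_eq_sq (X : Matrix (Fin m) (Fin n) ℝ) (Y : Matrix (Fin m) (Fin q) ℝ)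
    (k : Fin m) : normSq (X k) * normSq (Y k) = (rowNorms X k * rowNorms Y k) ^ 2 := by
  rw [mul_pow, rowNorms_sq, rowNorms_sq]

/-- **DKM06 Lemma 4, eqs. (5)–(6)**: "if `p_k = |A^{(k)}||B_{(k)}| / ∑_{k'} |A^{(k')}||B_{(k')}|`
then `E[‖AB − CR‖_F²] = (1/c)(∑_k |A^{(k)}||B_{(k)}|)² − (1/c)‖AB‖_F²`"; here, with
`p_k = ‖X(k,·)‖‖Y(k,·)‖ / ∑_l ‖X(l,·)‖‖Y(l,·)‖`,
`E‖XᵀSᵀSY − XᵀY‖_F² = ((∑_k ‖X(k,·)‖‖Y(k,·)‖)² − ‖XᵀY‖_F²)/s`.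
[cite: DrineasKannanMahoney2006, §4.3, Lemma 4, p. 141, eqs. (5)–(6)] -/
theorem iid_frobSq_sub_optimal (hA : 0 < ∑ l, rowNorms X l * rowNorms Y l)
    (hp : ∀ k, p k = rowNorms X k * rowNorms Y k / ∑ l, rowNorms X l * rowNorms Y l) (hs : s ≠ 0) :
    ∑ ω : Fin s → Fin m, iidWeight p ω * frobSq ((sketch p ω * X)ᵀ * (sketch p ω * Y) - Xᵀ * Y)
      = ((∑ k, rowNorms X k * rowNorms Y k) ^ 2 - frobSq (Xᵀ * Y)) / s := by
  have ha0 : ∀ k, 0 ≤ rowNorms X k * rowNorms Y k :=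
    fun k => mul_nonneg (Real.sqrt_nonneg _) (Real.sqrt_nonneg _)
  have hp0 : ∀ k, 0 ≤ p k := fun k => by rw [hp k]; exact div_nonneg (ha0 k) hA.le
  have hp1 : ∑ k, p k = 1 := by
    simp only [hp, ← Finset.sum_div]; exact div_self hA.ne'
  have hsupp : ∀ k, p k = 0 → X k = 0 ∨ Y k = 0 := by
    intro k hk
    rw [hp k, div_eq_zero_iff] at hk
    rcases hk with hk | hk
    · rcases mul_eq_zero.1 hk with h | h
      · left; unfold rowNorms at h
        exact (normSq_eq_zero_iff _).1 ((Real.sqrt_eq_zero (normSq_nonneg _)).1 h)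
      · right; unfold rowNorms at h
        exact (normSq_eq_zero_iff _).1 ((Real.sqrt_eq_zero (normSq_nonneg _)).1 h)
    · exact absurd hk hA.ne'
  rw [iid_frobSq_sub hp0 hp1 hsupp hs]
  congr 2
  simp only [normSq_mul_normSq_eq_sq]
  exact sum_sq_div_optimal _ _ hA hp

/-- **DKM06 Lemma 4, optimality**: "This choice of `p_k` minimizes `E[‖AB − CR‖_F²]` among
possible choices for the sampling probabilities" — for every probability vector `p` under which the
estimator is defined (`p_k > 0` wherever `‖X(k,·)‖‖Y(k,·)‖ ≠ 0`), the mean squared Frobenius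
error is at least the optimal value `((∑_k ‖X(k,·)‖‖Y(k,·)‖)² − ‖XᵀY‖_F²)/s` of eq. (6).
[cite: DrineasKannanMahoney2006, §4.3, Lemma 4, p. 141 (sentence after eq. (6)); proof
pp. 141–142] -/
theorem iid_frobSq_sub_ge_optimal (hp0 : ∀ k, 0 ≤ p k) (hp1 : ∑ k, p k = 1)
    (hsupp' : ∀ k, p k = 0 → rowNorms X k * rowNorms Y k = 0) (hs : s ≠ 0) :
    ((∑ k, rowNorms X k * rowNorms Y k) ^ 2 - frobSq (Xᵀ * Y)) / s
      ≤ ∑ ω : Fin s → Fin m,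
          iidWeight p ω * frobSq ((sketch p ω * X)ᵀ * (sketch p ω * Y) - Xᵀ * Y) := by
  have hsupp : ∀ k, p k = 0 → X k = 0 ∨ Y k = 0 := by
    intro k hk
    rcases mul_eq_zero.1 (hsupp' k hk) with h | h
    · left; unfold rowNorms at h
      exact (normSq_eq_zero_iff _).1 ((Real.sqrt_eq_zero (normSq_nonneg _)).1 h)
    · right; unfold rowNorms at h
      exact (normSq_eq_zero_iff _).1 ((Real.sqrt_eq_zero (normSq_nonneg _)).1 h)
  rw [iid_frobSq_sub hp0 hp1 hsupp hs]
  have hs' : (0 : ℝ) < s := Nat.cast_pos.2 (Nat.pos_of_ne_zero hs)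
  refine div_le_div_of_nonneg_right ?_ hs'.le
  have := sq_sum_le_sum_sq_div (fun k => rowNorms X k * rowNorms Y k) p hp0 hp1 hsupp'
  simp only [← normSq_mul_normSq_eq_sq] at this
  linarith

end optimal

end SampleQuery

end Literature.Computability.QuantumComplexity

end
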